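import Literature.MathematicalPhysics.QuantumFieldTheory.BalabanImbrieJaffe1984to88.BIJ88TruncatedExpectation5142Slots
import Literature.MathematicalPhysics.QuantumFieldTheory.BalabanImbrieJaffe1984to88.BIJ88RemainderW6Prime

/-!
# `BalabanImbrieJaffe1984to88.BIJ88RemainderW6Log` — [BalabanImbrieJaffe1988] CMP **114** (1988), Sect. 5.14 pp. 308–310:
**`log z₁ = log z₀ − 𝒫̃_{k+1} − (n̄+1)·Σ_{X⊂Λ₁₂} W₆^{(k)′}(X)`** — the chain *(5.14.2)* `ℛ_k = ∫₀¹dt −((1−t)^{n̄}/(n̄+1)!)⟨d/dt;…;d/dt⟩_t`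
∘ *p. 310 display 2* (the truncated functions) ∘ *p. 310 display 4* `ℛ_k(Λ₁₂^{(k)}) = Σ_{X⊂Λ₁₂^{(k)}} W₆^{(k)′}(X)`, end to end, BY NAME from
p25's `BIJ88RemainderW6Prime.remR_eq_sum_W6'_of_display2` (display 4 from display 2) and this seat's
`BIJ88TruncatedExpectation5142Slots.remR_sum_trunc_eq` ((5.14.2): the assignment-summed display-2 truncation is `(d/dt)^{n̄+1} log z_t`).

statement-level skeleton of published theorems with citation tags; proofs where landed; nothing here is a claim about the Yang–Mills mass gap

THE PRINT (p. 308 [PDF 52], read as an image this session, `lit-balaban-r16/renders/cmp114/original-p052-x2.png`): *"where z(Λ₁₂^{(k)}) =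
z_{F=1}(Λ₁₂^{(k)}), and we give expansions for z_F/z and log z. … the second to 𝒫^L_{k+1,loc} plus remainders. We consider only log z for
the moment. … 𝒫̃_{k+1}(Λ₁₂^{(k)}) = Σ_{α=1}^{n̄} −(1/α!)(d^α/dt^α) log z_t(Λ₁₂^{(k)})|_{t=0}, and a remainder
ℛ_k(Λ₁₂^{(k)}) = ∫₀¹ dt −((1−t)^{n̄}/(n̄+1)!) ⟨d/dt; …; d/dt⟩_t. (5.14.2)"*; p. 310 [PDF 54] display 4 (p25's header of `BIJ88RemainderW6Prime`):
*"ℛ_k(Λ₁₂^{(k)}) = Σ_{X⊂Λ₁₂^{(k)}} W₆^{(k)′}(X)"*.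

WHAT IS PROVED (theorems only; no `def`, no `Prop` fact).
* §1 `sum_piFinset_pin_eq_sum_asg`, `piFinset_pin_univ` — transport between p25's `T`-valued assignment products
  (`BIJ88W6PrimeBound.assignments = Fintype.piFinset (fun _ => A)`, `A` = the slots of `Γ` located in `Λ`; here also pinned off a label set `K`)
  and the `asg` of `BIJ88TruncatedExpectation5142Slots` for the slot type `↥A`.
* §2 **`sum_W6'_eq_taylorRemainder_log`**: under p25's hypotheses of `remR_eq_sum_W6'_of_display2` VERBATIM (normalization `N_γ(∅) ≠ 0`,
  summability of the connected and of the term series, display 2 for every assignment `γ` with truncations `κ_t(γ,·)`, integrability of the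
  region sums) plus: the truncations are slot-local in `γ` (`hκloc`), and the normalized moments `N_γ(K)/N_γ(∅)` summed over the assignments
  of the labels of `K` are the derivative moments `z_t^{(|K|)}/z_t` of a positive `C^{n̄+1}` function `z` on `[0,1]` (`hN`, Leibniz: *"We express
  each d/dt as a sum Σ_γ (d/dt)_γ"*) — `Σ_{X⊂Λ} W₆′(X) = −(1/(n̄+1)) ∫₀¹ ((1−t)^{n̄}/n̄!) (d/dt)^{n̄+1} log z_t dt`; and
  **`log_z_one_eq_sub_pertP_sub_sum_W6'`**: `log z₁ = log z₀ − 𝒫̃_{k+1} − (n̄+1)·Σ_{X⊂Λ} W₆′(X)` (r16's `pertP`, `taylor_logz` BY NAME).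
  The factor `n̄+1` is the located print slip of (5.14.2) (`(n̄+1)!` for Taylor's `n̄!`; GAPS G-C2-p36-06, owner r16 to rule): p25's `W6'`
  carries the printed weight, so *"log z = log z₀ − 𝒫̃_{k+1} − ℛ_k"* with `ℛ_k = Σ_X W₆′(X)` holds up to exactly this factor.

HONEST SCOPE.  Every analytic input is a displayed hypothesis (p25's five, locality, positivity/smoothness of `z`, the Leibniz sums); the
identification of p25's normalization `Nsum … ∅` with `z_t` and of the assignment-summed moments with `z_t^{(j)}` (cluster expansion (5.14.3) +
Leibniz) is NOT derived here; (5.14.4) and the `W₆′` bound are p25's separate theorems (`remR_eq_sum_W6'_of_ineq5144`, `BIJ88W6PrimeBound`).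
0 `sorry`; axioms standard.

CITATION HEADER (lean-in-tree rule).  lit-balaban TYPED SKELETON (HOME `run/shared/lean/pub/lit-balaban/`), Phase 2, seat p36 gen 9
(unit `lit-balaban-p36`); rows **C2.Eq5.14.1-5.14.2** ((5.14.2)) and **C2.Claim@310** (displays 2, 4) of `HOME/lit-balaban-r16/ROWS-C2-part2.md`
(owner r16; heads untouched; p25's decls used BY NAME, nothing restated).  PDF held: `paper:balaban1988-cmp114-bij-abelian-higgs-effective-action`
(journal page = PDF page + 256).  NOT summit progress.
-/

open Finset MeasureTheory
open Literature.Probability.LatticeModels (setPartitions)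
open Literature.MathematicalPhysics.QuantumFieldTheory.BalabanImbrieJaffe1984to88.BIJ88Sect5StatementsPart4 (remR pertP taylor_logz)
open Literature.MathematicalPhysics.QuantumFieldTheory.BalabanImbrieJaffe1984to88.BIJ88Ineq5113Covering (polys)
open Literature.MathematicalPhysics.QuantumFieldTheory.BalabanImbrieJaffe1984to88.BIJ88W6PrimeBound (assignments mem_assignments term trunc W6')
open Literature.MathematicalPhysics.QuantumFieldTheory.BalabanImbrieJaffe1984to88.BIJ88ConnectedGraphResummation (Nsum Tord)
open Literature.MathematicalPhysics.QuantumFieldTheory.BalabanImbrieJaffe1984to88.BIJ88RemainderW6Prime (remR_eq_sum_W6'_of_display2)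
open Literature.MathematicalPhysics.QuantumFieldTheory.BalabanImbrieJaffe1984to88.BIJ88TruncatedExpectation5142

noncomputable section

namespace Literature.MathematicalPhysics.QuantumFieldTheory.BalabanImbrieJaffe1984to88.BIJ88RemainderW6Log

/-! ## §1 Transport: assignments with values in a slot finset `A`, pinned off `K`, versus functions into the subtype `↥A` -/

section Transport

variable {α : Type*} [Fintype α] [DecidableEq α] {T : Type*} {M : Type*} [AddCommMonoid M]

/-- The sum over the `A`-valued assignments of the labels of `K` (pinned to `s₀ ∈ A` off `K`) is the sum over the `asg` of
`BIJ88TruncatedExpectation5142Slots` for the slot type `↥A`. [cite: BalabanImbrieJaffe1988, (5.14.2) p.308] -/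
theorem sum_piFinset_pin_eq_sum_asg (A : Finset T) {s₀ : T} (hs₀ : s₀ ∈ A) (K : Finset α) (F : (α → T) → M) :
    ∑ γ ∈ Fintype.piFinset (fun j => if j ∈ K then A else {s₀}), F γ =
      ∑ γ' ∈ asg (⟨s₀, hs₀⟩ : A) K, F (fun j => (γ' j : T)) := by
  classical
  symm
  refine sum_nbij' (fun γ' => fun j => (γ' j : T))
    (fun γ => fun j => if h : γ j ∈ A then ⟨γ j, h⟩ else ⟨s₀, hs₀⟩) ?_ ?_ ?_ ?_ (fun _ _ => rfl)
  · intro γ' hγ'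
    refine Fintype.mem_piFinset.2 fun j => ?_
    by_cases hj : j ∈ K
    · simp [hj]
    · simp [hj, mem_asg.1 hγ' j hj]
  · intro γ hγ
    refine mem_asg.2 fun j hj => ?_
    have h := Fintype.mem_piFinset.1 hγ j
    simp only [hj, if_false, mem_singleton] at h
    simp [h, hs₀]
  · intro γ' _
    funext j
    simp
  · intro γ hγ
    funext j
    have h := Fintype.mem_piFinset.1 hγ j
    have hA : γ j ∈ A := by
      by_cases hj : j ∈ K
      · simpa [hj] using h
      · simp only [hj, if_false, mem_singleton] at h
        exact h ▸ hs₀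
    simp [hA]

/-- All labels free: the pinned assignment set is the full product `A^{labels}`. [cite: BalabanImbrieJaffe1988, (5.14.2) p.308] -/
theorem piFinset_pin_univ (A : Finset T) (s₀ : T) :
    (Fintype.piFinset fun j : α => if j ∈ (univ : Finset α) then A else {s₀}) = Fintype.piFinset fun _ : α => A := by
  simp

end Transport

/-! ## §2 `log z₁ = log z₀ − 𝒫̃_{k+1} − (n̄+1)·Σ_X W₆^{(k)′}(X)`: (5.14.2) ∘ (display 2) ∘ (display 4) -/

section Main

variable {V : Type} [DecidableEq V] [Fintype V] {T : Type}
variable {R : V → V → Prop} {nbar : ℕ} {Γ : Finset T} {loc : T → V}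
  {g₃ : ℝ → (Fin (nbar + 1) → T) → Finset (Fin (nbar + 1)) → Finset V → ℝ}

/-- **`Σ_{X ⊂ Λ₁₂} W₆^{(k)′}(X) = −(1/(n̄+1)) ∫₀¹ ((1−t)^{n̄}/n̄!) (d/dt)^{n̄+1} log z_t dt`.**  p25's p.310 display 4
`ℛ_k(Λ₁₂) = Σ_X W₆′(X)` (`BIJ88RemainderW6Prime.remR_eq_sum_W6'_of_display2`, its hypotheses verbatim: normalization `≠ 0`, summability of
the connected and term series, display 2 for every assignment `γ`, integrability) COMPOSED with (5.14.2)/display 2 of this seat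
(`BIJ88TruncatedExpectation5142Slots.remR_sum_trunc_eq`): if moreover the display-2 truncations are slot-local in `γ` and the normalized
moments `N(K)/N(∅)` sum, over the assignments of the labels of `K` (pinned off `K`), to the derivative moments `z_t^{(|K|)}/z_t` of a positive
`C^{n̄+1}` function `z` on `[0,1]` (Leibniz), then the sum of the `W₆′` is the Taylor remainder of `log z` divided by `−(n̄+1)` — the printed
weight `(n̄+1)!` of (5.14.2) at work (GAPS G-C2-p36-06). [cite: BalabanImbrieJaffe1988, (5.14.2) p.308; p.310 displays 2, 4] -/
theorem sum_W6'_eq_taylorRemainder_log (Λ : Finset V) {s₀ : T} (hs₀ : s₀ ∈ Γ.filter fun τ => loc τ ∈ Λ)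
    (κ : ℝ → (Fin (nbar + 1) → T) → Finset (Fin (nbar + 1)) → ℝ)
    (hz : ∀ t ∈ Set.uIcc (0 : ℝ) 1, ∀ γ ∈ assignments nbar Γ loc Λ, Nsum (polys R Λ) (loc ∘ γ) (g₃ t γ) ∅ ≠ 0)
    (hT : ∀ t ∈ Set.uIcc (0 : ℝ) 1, ∀ γ ∈ assignments nbar Γ loc Λ, ∀ b : Finset (Fin (nbar + 1)), b.Nonempty →
      Summable fun m => ‖Tord (polys R Λ) (loc ∘ γ) (g₃ t γ) m b‖)
    (hs : ∀ t ∈ Set.uIcc (0 : ℝ) 1, ∀ γ ∈ assignments nbar Γ loc Λ, ∀ X ⊆ Λ, Summable fun n => term R nbar loc g₃ t γ X n)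
    (hκ : ∀ t ∈ Set.uIcc (0 : ℝ) 1, ∀ γ ∈ assignments nbar Γ loc Λ, ∀ K : Finset (Fin (nbar + 1)), K.Nonempty →
      Nsum (polys R Λ) (loc ∘ γ) (g₃ t γ) K / Nsum (polys R Λ) (loc ∘ γ) (g₃ t γ) ∅ =
        ∑ π ∈ setPartitions K, ∏ b ∈ π, κ t γ b)
    (hint : ∀ X ⊆ Λ, IntervalIntegrable (fun t => ∑ γ ∈ assignments nbar Γ loc X, trunc R nbar loc g₃ t γ X) volume 0 1)
    (hκloc : ∀ t, ∀ B : Finset (Fin (nbar + 1)), ∀ γ ∈ assignments nbar Γ loc Λ, ∀ γ' ∈ assignments nbar Γ loc Λ,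
      (∀ j ∈ B, γ j = γ' j) → κ t γ B = κ t γ' B)
    {z : ℝ → ℝ} (hzC : ContDiffOn ℝ (nbar + 1 : ℕ) z (Set.uIcc 0 1)) (hzpos : ∀ t ∈ Set.uIcc (0 : ℝ) 1, 0 < z t)
    (hN : ∀ t ∈ Set.uIcc (0 : ℝ) 1, ∀ K : Finset (Fin (nbar + 1)), K.Nonempty →
      ∑ γ ∈ Fintype.piFinset (fun j => if j ∈ K then Γ.filter (fun τ => loc τ ∈ Λ) else {s₀}),
        Nsum (polys R Λ) (loc ∘ γ) (g₃ t γ) K / Nsum (polys R Λ) (loc ∘ γ) (g₃ t γ) ∅ =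
          iteratedDerivWithin K.card z (Set.uIcc 0 1) t / z t) :
    ∑ X ∈ Λ.powerset, W6' R nbar Γ loc g₃ X = -(1 / (nbar + 1 : ℝ)) *
      ∫ t in (0 : ℝ)..1, ((1 - t) ^ nbar / nbar.factorial) *
        iteratedDerivWithin (nbar + 1) (fun x => Real.log (z x)) (Set.uIcc 0 1) t := by
  -- every `↥A`-valued assignment (`A` = the slots located in `Λ`) is one of p25's assignments
  have hmem : ∀ γ' : Fin (nbar + 1) → ↥(Γ.filter fun τ => loc τ ∈ Λ), (fun j => (γ' j : T)) ∈ assignments nbar Γ loc Λ :=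
    fun γ' => mem_assignments.2 fun j => mem_filter.1 (γ' j).2
  have h25 := remR_eq_sum_W6'_of_display2 R nbar Γ loc g₃ Λ κ hz hT hs hκ hint
  have hF3 := remR_sum_trunc_eq (α := Fin (nbar + 1)) (S := ↥(Γ.filter fun τ => loc τ ∈ Λ)) (by rw [Fintype.card_fin])
    (⟨s₀, hs₀⟩ : ↥(Γ.filter fun τ => loc τ ∈ Λ)) hzC hzpos
    (N := fun t K γ' => Nsum (polys R Λ) (loc ∘ fun j => (γ' j : T)) (g₃ t fun j => (γ' j : T)) K /
      Nsum (polys R Λ) (loc ∘ fun j => (γ' j : T)) (g₃ t fun j => (γ' j : T)) ∅)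
    (κ := fun t B γ' => κ t (fun j => (γ' j : T)) B)
    (fun t B γ' γ'' hγ => hκloc t B _ (hmem γ') _ (hmem γ'') fun j hj => by simp [hγ j hj])
    (fun t ht γ' K hK => hκ t ht _ (hmem γ') K hK)
    (fun t ht K hK => by
      rw [← hN t ht K hK, sum_piFinset_pin_eq_sum_asg (Γ.filter fun τ => loc τ ∈ Λ) hs₀ K])
  rw [← h25, ← hF3]
  congr 1
  funext t
  have hasg : assignments nbar Γ loc Λ =
      Fintype.piFinset (fun j : Fin (nbar + 1) => if j ∈ (univ : Finset (Fin (nbar + 1))) then Γ.filter (fun τ => loc τ ∈ Λ) else {s₀}) := by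
    rw [piFinset_pin_univ]
    rfl
  rw [hasg, sum_piFinset_pin_eq_sum_asg (Γ.filter fun τ => loc τ ∈ Λ) hs₀ univ, asg_univ]

/-- **`log z₁ = log z₀ − 𝒫̃_{k+1} − (n̄+1)·Σ_{X⊂Λ₁₂} W₆^{(k)′}(X)`** — the end-to-end form of p. 308 *"we give expansions for … log z"*
with the paper's own objects: `𝒫̃_{k+1}` of (5.14.1)/(5.14.2) (r16's `pertP`), the remainder resummed as on p. 310 (`Σ_X W₆′(X)`, p25's
`W6'` carrying the printed weight `(1−t)^{n̄}/(n̄+1)!`), and the located factor `n̄+1` (GAPS G-C2-p36-06); same hypotheses as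
`sum_W6'_eq_taylorRemainder_log`. [cite: BalabanImbrieJaffe1988, (5.14.2) p.308; p.310 displays 2, 4] -/
theorem log_z_one_eq_sub_pertP_sub_sum_W6' (Λ : Finset V) {s₀ : T} (hs₀ : s₀ ∈ Γ.filter fun τ => loc τ ∈ Λ)
    (κ : ℝ → (Fin (nbar + 1) → T) → Finset (Fin (nbar + 1)) → ℝ)
    (hz : ∀ t ∈ Set.uIcc (0 : ℝ) 1, ∀ γ ∈ assignments nbar Γ loc Λ, Nsum (polys R Λ) (loc ∘ γ) (g₃ t γ) ∅ ≠ 0)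
    (hT : ∀ t ∈ Set.uIcc (0 : ℝ) 1, ∀ γ ∈ assignments nbar Γ loc Λ, ∀ b : Finset (Fin (nbar + 1)), b.Nonempty →
      Summable fun m => ‖Tord (polys R Λ) (loc ∘ γ) (g₃ t γ) m b‖)
    (hs : ∀ t ∈ Set.uIcc (0 : ℝ) 1, ∀ γ ∈ assignments nbar Γ loc Λ, ∀ X ⊆ Λ, Summable fun n => term R nbar loc g₃ t γ X n)
    (hκ : ∀ t ∈ Set.uIcc (0 : ℝ) 1, ∀ γ ∈ assignments nbar Γ loc Λ, ∀ K : Finset (Fin (nbar + 1)), K.Nonempty →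
      Nsum (polys R Λ) (loc ∘ γ) (g₃ t γ) K / Nsum (polys R Λ) (loc ∘ γ) (g₃ t γ) ∅ =
        ∑ π ∈ setPartitions K, ∏ b ∈ π, κ t γ b)
    (hint : ∀ X ⊆ Λ, IntervalIntegrable (fun t => ∑ γ ∈ assignments nbar Γ loc X, trunc R nbar loc g₃ t γ X) volume 0 1)
    (hκloc : ∀ t, ∀ B : Finset (Fin (nbar + 1)), ∀ γ ∈ assignments nbar Γ loc Λ, ∀ γ' ∈ assignments nbar Γ loc Λ,
      (∀ j ∈ B, γ j = γ' j) → κ t γ B = κ t γ' B)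
    {z : ℝ → ℝ} (hzC : ContDiffOn ℝ (nbar + 1 : ℕ) z (Set.uIcc 0 1)) (hzpos : ∀ t ∈ Set.uIcc (0 : ℝ) 1, 0 < z t)
    (hN : ∀ t ∈ Set.uIcc (0 : ℝ) 1, ∀ K : Finset (Fin (nbar + 1)), K.Nonempty →
      ∑ γ ∈ Fintype.piFinset (fun j => if j ∈ K then Γ.filter (fun τ => loc τ ∈ Λ) else {s₀}),
        Nsum (polys R Λ) (loc ∘ γ) (g₃ t γ) K / Nsum (polys R Λ) (loc ∘ γ) (g₃ t γ) ∅ =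
          iteratedDerivWithin K.card z (Set.uIcc 0 1) t / z t) :
    Real.log (z 1) = Real.log (z 0) - pertP (fun x => Real.log (z x)) nbar -
      (nbar + 1 : ℝ) * ∑ X ∈ Λ.powerset, W6' R nbar Γ loc g₃ X := by
  rw [sum_W6'_eq_taylorRemainder_log Λ hs₀ κ hz hT hs hκ hint hκloc hzC hzpos hN]
  have hℓ : ContDiffOn ℝ (nbar + 1 : ℕ) (fun x => Real.log (z x)) (Set.uIcc 0 1) := hzC.log fun x hx => (hzpos x hx).ne'
  rw [taylor_logz (nbar := nbar) hℓ]
  have hn : ((nbar : ℝ) + 1) ≠ 0 := Nat.cast_add_one_ne_zero nbar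
  field_simp
  ring

end Main

end Literature.MathematicalPhysics.QuantumFieldTheory.BalabanImbrieJaffe1984to88.BIJ88RemainderW6Log

end
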